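import Mathlib
import Summits.Ventures.PercRepro2.HCov
import Summits.Ventures.PercRepro2.CCTRootEdge
import Summits.Ventures.PercRepro2.A3Fibre
import Summits.Ventures.PercRepro2.A3FibreLeft

/-!
# The a₃-fibres at a pinned root edge (blind cell PercRepro2, p5 g13; `proofs/P5-ROOTEDGE.md` §6 —
the first block of the (MEANS-a₃)-level root-edge closure)

Let `e = {a₁, a₃}` be a root edge at `a₃`.  For the fibres `fibre W = Q ∩ {C(a₃) = W}` of the
a₃-exploration:

* if `a₁ ∉ W` the fibre forces `e` closed (`fibre_subset_closedEdge`): its masses at `p` are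
  `(1 − p e)` times the masses at `p[e ↦ 0]` (`prob_fibre_inter_eq_pin`) and vanish at `p[e ↦ 1]`
  (`prob_one_fibre_inter`);
* if `a₁ ∈ W` (and `a₂ ∉ W`) both ends of `e` lie in `W`, and the fibre means are INVARIANT under a
  change of `p e`: the deleted-graph event `Rv` does not see `e` (`restrict_update_of_notMem`,
  `Rv_update_iff`, `prob_Rv_update`), so with `A3FibreLeft.prob_cl_conn_left / _right`
  `Ssig p' W = mW p' W · cb`, `Su p' W = mW p' W · cu` for every `p' = p[e ↦ q]` with the SAME
  constants `cb = 1_{b ∈ W} − (1 − 1_{b ∈ W})·P_p(Rv b)`, `cu = 1_{v ∈ W} + (1 − 1_{v ∈ W})·P_p(Rv v)`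
  (`Ssig_update_eq_mul`, `Su_update_eq_mul`).
-/

namespace Summit.Ventures.PercRepro2

open UnionCluster

namespace CovForm

namespace RootEdge

open CCT A3Fibre

section Fibres

variable {V : Type*} {E : Type*} [Fintype V] [DecidableEq V] [Fintype E] [DecidableEq E]
  {R : Type*} [Field R] [LinearOrder R] [IsStrictOrderedRing R]

variable {ends : E → Sym2 V} {e : E} {a₁ a₂ a₃ : V}

omit [Fintype V] [DecidableEq V] [Fintype E] [DecidableEq E] in
/-- A fibre with `a₁ ∉ W` lies inside `{e closed}`. -/
lemma fibre_subset_closedEdge (hends : ends e = s(a₁, a₃)) {W : Finset V} (h₁ : a₁ ∉ W) :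
    fibre ends a₁ a₂ a₃ W ⊆ closedEdge e := by
  intro ω hω
  by_contra hopen
  simp only [closedEdge, Set.mem_setOf_eq, Bool.not_eq_false] at hopen
  have hc : Conn ends ω a₁ a₃ := conn_of_openAdj ⟨e, hopen, hends⟩
  have hW : cluster ends ω a₃ = (↑W : Set V) := hω.2
  have : a₁ ∈ cluster ends ω a₃ := mem_cluster.2 (conn_symm hc)
  rw [hW] at this
  exact h₁ (Finset.mem_coe.1 this)

omit [Fintype V] [DecidableEq V] [LinearOrder R] [IsStrictOrderedRing R] in
/-- For `a₁ ∉ W` the fibre masses at `p` are `(1 − p e)` times those at `p[e ↦ 0]`. -/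
lemma prob_fibre_inter_eq_pin (p : E → R) (hends : ends e = s(a₁, a₃)) {W : Finset V}
    (h₁ : a₁ ∉ W) (X : Set (Config E)) :
    prob p (fibre ends a₁ a₂ a₃ W ∩ X) =
      (1 - p e) * prob (Function.update p e 0) (fibre ends a₁ a₂ a₃ W ∩ X) := by
  rw [← prob_inter_closedEdge]
  congr 1
  ext ω
  simp only [Set.mem_inter_iff]
  exact ⟨fun h => ⟨h, fibre_subset_closedEdge hends h₁ h.1⟩, fun h => h.1⟩

omit [Fintype V] [DecidableEq V] [LinearOrder R] [IsStrictOrderedRing R] in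
/-- For `a₁ ∉ W` the fibre is null at `p[e ↦ 1]`. -/
lemma prob_one_fibre_inter (p : E → R) (hends : ends e = s(a₁, a₃)) {W : Finset V}
    (h₁ : a₁ ∉ W) (X : Set (Config E)) :
    prob (Function.update p e 1) (fibre ends a₁ a₂ a₃ W ∩ X) = 0 := by
  rw [← prob_update_one_inter_closedEdge p (fibre ends a₁ a₂ a₃ W ∩ X) e]
  congr 1
  ext ω
  simp only [Set.mem_inter_iff]
  exact ⟨fun h => ⟨h, fibre_subset_closedEdge hends h₁ h.1⟩, fun h => h.1⟩

/-! ### The deleted-graph events do not see an edge inside `W` -/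

omit [Fintype V] [DecidableEq V] [Fintype E] in
/-- `restrict F` ignores an edge outside `F`. -/
lemma restrict_update_of_notMem {F : Set E} [DecidablePred (· ∈ F)] {e : E} (h : e ∉ F)
    (ω : Config E) (b : Bool) :
    restrict F (Function.update ω e b) = restrict F ω := by
  funext e'
  by_cases he : e' = e
  · subst he
    simp [restrict, h]
  · simp [restrict, Function.update_of_ne he]

omit [Fintype E] in
/-- With `a₁ ∈ W`, the edge `e = {a₁, a₃}` touches `W`, so `Rv` does not see it. -/
lemma Rv_update_iff (hends : ends e = s(a₁, a₃)) {W : Finset V} (h₁ : a₁ ∈ W) (v : V)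
    (ω : Config E) (b : Bool) :
    Function.update ω e b ∈ Rv ends a₂ v W ↔ ω ∈ Rv ends a₂ v W := by
  have he : e ∉ (touches ends (↑W : Set V))ᶜ := by
    simp only [Set.mem_compl_iff, not_not]
    exact mem_touches_of_ends hends (Or.inl (Finset.mem_coe.2 h₁))
  unfold Rv
  simp only [Set.mem_setOf_eq]
  rw [restrict_update_of_notMem he]

omit [LinearOrder R] [IsStrictOrderedRing R] in
/-- The probability of `Rv` is the same at every pinned weight of `e` (`a₁ ∈ W`). -/
lemma prob_Rv_update (p : E → R) (hends : ends e = s(a₁, a₃)) {W : Finset V} (h₁ : a₁ ∈ W)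
    (v : V) (q : R) :
    prob (Function.update p e q) (Rv ends a₂ v W) = prob p (Rv ends a₂ v W) := by
  have h1 : prob (Function.update p e 1) (Rv ends a₂ v W) = prob p (Rv ends a₂ v W) := by
    rw [prob_update_one_eq]
    congr 1
    ext ω
    simp only [Set.mem_setOf_eq, Rv_update_iff hends h₁ v ω]
  have h0 : prob (Function.update p e 0) (Rv ends a₂ v W) = prob p (Rv ends a₂ v W) := by
    rw [prob_update_zero_eq]
    congr 1
    ext ω
    simp only [Set.mem_setOf_eq, Rv_update_iff hends h₁ v ω]
  rw [prob_eq_pin (Function.update p e q) _ e, Function.update_idem, Function.update_idem,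
    Function.update_self, h1, h0]
  ring

/-! ### The T′-fibre means are invariant under the weight of `e` -/

omit [LinearOrder R] [IsStrictOrderedRing R] in
/-- On a T′-fibre (`a₁ ∈ W`, `a₂ ∉ W`), `Ssig p' W = mW p' W · cb` with the `e`-free constant
`cb = 1_{b ∈ W} − (1 − 1_{b ∈ W})·P_p(Rv b)`, at `p' = p[e ↦ q]`. -/
lemma Ssig_update_eq_mul (p : E → R) (hends : ends e = s(a₁, a₃)) {W : Finset V} (h₁ : a₁ ∈ W)
    (h₂ : a₂ ∉ W) (b : V) (q : R) :
    Ssig (Function.update p e q) ends a₁ a₂ a₃ b W =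
      mW (Function.update p e q) ends a₁ a₂ a₃ W *
        (if b ∈ W then (1 : R) else -prob p (Rv ends a₂ b W)) := by
  unfold Ssig mW
  rw [fibre_eq_of_mem_left ends a₁ a₂ a₃ h₁ h₂, prob_cl_conn_left _ ends a₁ a₃ b h₁,
    prob_cl_conn_right _ ends a₂ a₃ b h₂, prob_Rv_update p hends h₁ b q]
  split_ifs <;> ring

omit [LinearOrder R] [IsStrictOrderedRing R] in
/-- The same at `p` itself. -/
lemma Ssig_eq_mul (p : E → R) {W : Finset V} (h₁ : a₁ ∈ W) (h₂ : a₂ ∉ W) (b : V) :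
    Ssig p ends a₁ a₂ a₃ b W =
      mW p ends a₁ a₂ a₃ W * (if b ∈ W then (1 : R) else -prob p (Rv ends a₂ b W)) := by
  unfold Ssig mW
  rw [fibre_eq_of_mem_left ends a₁ a₂ a₃ h₁ h₂, prob_cl_conn_left _ ends a₁ a₃ b h₁,
    prob_cl_conn_right _ ends a₂ a₃ b h₂]
  split_ifs <;> ring

omit [LinearOrder R] [IsStrictOrderedRing R] in
/-- On a T′-fibre, `Su p' W = mW p' W · cu` with `cu = 1_{v ∈ W} + (1 − 1_{v ∈ W})·P_p(Rv v)`. -/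
lemma Su_update_eq_mul (p : E → R) (hends : ends e = s(a₁, a₃)) {W : Finset V} (h₁ : a₁ ∈ W)
    (h₂ : a₂ ∉ W) (v : V) (q : R) :
    Su (Function.update p e q) ends a₁ a₂ a₃ v W =
      mW (Function.update p e q) ends a₁ a₂ a₃ W *
        (if v ∈ W then (1 : R) else prob p (Rv ends a₂ v W)) := by
  unfold Su mW
  rw [fibre_eq_of_mem_left ends a₁ a₂ a₃ h₁ h₂, prob_cl_conn_left _ ends a₁ a₃ v h₁,
    prob_cl_conn_right _ ends a₂ a₃ v h₂, prob_Rv_update p hends h₁ v q]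
  split_ifs <;> ring

omit [LinearOrder R] [IsStrictOrderedRing R] in
/-- The same at `p` itself. -/
lemma Su_eq_mul (p : E → R) {W : Finset V} (h₁ : a₁ ∈ W) (h₂ : a₂ ∉ W) (v : V) :
    Su p ends a₁ a₂ a₃ v W =
      mW p ends a₁ a₂ a₃ W * (if v ∈ W then (1 : R) else prob p (Rv ends a₂ v W)) := by
  unfold Su mW
  rw [fibre_eq_of_mem_left ends a₁ a₂ a₃ h₁ h₂, prob_cl_conn_left _ ends a₁ a₃ v h₁,
    prob_cl_conn_right _ ends a₂ a₃ v h₂]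
  split_ifs <;> ring

omit [Fintype V] [DecidableEq V] [LinearOrder R] [IsStrictOrderedRing R] in
/-- The fibre masses pin: `mW p W = p e · mW p[e↦1] W + (1 − p e) · mW p[e↦0] W`. -/
lemma mW_eq_pin (p : E → R) (W : Finset V) :
    mW p ends a₁ a₂ a₃ W =
      p e * mW (Function.update p e 1) ends a₁ a₂ a₃ W +
        (1 - p e) * mW (Function.update p e 0) ends a₁ a₂ a₃ W := by
  unfold mW
  exact prob_eq_pin p _ e

end Fibres

end RootEdge

end CovForm

end Summit.Ventures.PercRepro2
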